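/-
Origin: expansion seat `planner-pub-hodgecm-pv10-g3-0`, handover #7 2026-08-18T09:23:36Z (`HOME/pub-hodgecm-pv10-g3/lean/Pv10g3/GodementSharp.lean`, md5 d15067b9, 150 lines);
landed by the gen-7 packager in gate run 27 as `HodgeCM/PerL34/GodementSharp.lean` (import ^import Pv10g3\.→import HodgeCM.PerL34. ×1).
-/
/-
HodgeCM / PerL §3–4 layer — publication cell pub-hodgecm, DAG-NODE PROVER #10 gen 3 (pub-hodgecm-pv10-g3), file #7.
Imports: my `GodementCompact` (#5) and the tree's `HodgeCM.Model.Inhabited` (a bundled CM field `cyclo7 = ℚ(ζ₇)`).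
Complete proofs, no new axioms, no new hypotheses.
-/
import Summits.HodgeConjecture.HodgeCM.PerL34.GodementCompact_2
import Summits.HodgeConjecture.HodgeCM.Model.Inhabited

/-!
# The anisotropy hypothesis of `PrintFact_unitaryCompact` cannot be dropped

The tree's docstring of `HodgeCM.PrintFact_unitaryCompact` (`Automorphic/AdelicUnitaryModel.lean`) says:
"(Its unconditional variant — all hermitian `H` — is false.)".  This file makes that remark a KERNEL theorem:

* `ideleNormDet` — the continuous function `g ↦ ‖det g‖_𝔸` on `U(H)(𝔸)`, constant on the cosets of `U(H)(L⁺)`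
  (product formula), hence a continuous function `ideleNormDetQuot` on `U(H)(𝔸) / U(H)(L⁺)`;
* `not_adelicQuotientCompact_zero` — for the (hermitian, isotropic) ZERO form `H = 0 ∈ M_n(L)`, `n ≥ 1`, one has
  `U(0) = GL_n` and `GL_n(L)\GL_n(𝔸_L)` is NOT compact: `‖det ·‖_𝔸` is unbounded on it (scalar ideles `z(r)`,
  `‖z(r)‖ = r^[L:ℚ]`, Weil BNT IV §4), while a continuous function on a compact space is bounded;
* `not_printFact_unitaryCompact_unconditional` — hence
  `¬ ∀ L n H, H hermitian → AdelicQuotientCompact L H` (witness `L = ℚ(ζ₇)`, `n = 1`, `H = 0`).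

So in `PrintFact_unitaryCompact` (now the theorem `HodgeCM.printFact_unitaryCompact_holds`, #5) the hypothesis
`IsAnisotropic L H` is doing work.  (The full converse — every ISOTROPIC non-degenerate hermitian `H` has a
non-compact quotient — is not attempted here.)
-/

set_option autoImplicit false

noncomputable section

open scoped NNReal Matrix MatrixGroups
open NumberField IsDedekindDomain

namespace HodgeCM.PerL34.Godement

open Literature.NumberTheory Literature.NumberTheory.Automorphic HodgeCM.PerL34.Mahler
open Literature.AlgebraicGeometry.ShimuraVarieties HodgeCM.Adelic

variable (L : Type) [Field L] [NumberField L] [IsCMField L]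
variable {n : ℕ}

local notation "𝔸L" => AdeleRing (𝓞 L) L

/-! ## `‖det ·‖_𝔸` on `U(H)(𝔸)` and on the quotient -/

/-- `g ↦ ‖det g‖_𝔸` on the adelic unitary group. -/
def ideleNormDet (H : Matrix (Fin n) (Fin n) L) (g : adelicUnitaryGroup L H) : ℝ≥0 :=
  IdeleClassGroup.ideleNorm L (Matrix.GeneralLinearGroup.det (g : GL (Fin n) 𝔸L))

/-- (Ported verbatim from the HodgeCMPerL package; no docstring in the source.) -/
theorem continuous_ideleNormDet (H : Matrix (Fin n) (Fin n) L) : Continuous (ideleNormDet L H) :=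
  ((continuous_ideleNorm_holds L).comp continuous_det).comp continuous_subtype_val

/-- `‖det γ‖_𝔸 = 1` for rational `γ ∈ U(H)(L⁺)` (product formula). -/
theorem ideleNormDet_eq_one_of_mem_rat (H : Matrix (Fin n) (Fin n) L) {γ : adelicUnitaryGroup L H}
    (hγ : γ ∈ adelicUnitaryRat L H) : ideleNormDet L H γ = 1 := by
  obtain ⟨g, -, hg⟩ := (mem_adelicUnitaryRat_iff L H γ).mp hγ
  unfold ideleNormDet
  rw [← hg, toAdeleGL_eq_map]
  exact ideleNorm_det_map n L g

/-- `‖det ·‖_𝔸` is constant on the cosets `g · U(H)(L⁺)`. -/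
theorem ideleNormDet_mul_of_mem_rat (H : Matrix (Fin n) (Fin n) L) (g : adelicUnitaryGroup L H)
    {γ : adelicUnitaryGroup L H} (hγ : γ ∈ adelicUnitaryRat L H) :
    ideleNormDet L H (g * γ) = ideleNormDet L H g := by
  have h1 := ideleNormDet_eq_one_of_mem_rat L H hγ
  unfold ideleNormDet at h1 ⊢
  rw [Subgroup.coe_mul, map_mul, map_mul, h1, mul_one]

/-- The descent of `‖det ·‖_𝔸` to `U(H)(𝔸) / U(H)(L⁺)`. -/
def ideleNormDetQuot (H : Matrix (Fin n) (Fin n) L) :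
    adelicUnitaryGroup L H ⧸ adelicUnitaryRat L H → ℝ≥0 :=
  Quotient.lift (s := QuotientGroup.leftRel (adelicUnitaryRat L H)) (ideleNormDet L H)
    (fun a b hab => by
      have hmem : a⁻¹ * b ∈ adelicUnitaryRat L H := QuotientGroup.leftRel_apply.mp hab
      have h := ideleNormDet_mul_of_mem_rat L H a hmem
      rw [mul_inv_cancel_left] at h
      exact h.symm)

/-- (Ported verbatim from the HodgeCMPerL package; no docstring in the source.) -/
theorem continuous_ideleNormDetQuot (H : Matrix (Fin n) (Fin n) L) :
    Continuous (ideleNormDetQuot L H) :=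
  Continuous.quotient_lift (continuous_ideleNormDet L H) _

/-- (Ported verbatim from the HodgeCMPerL package; no docstring in the source.) -/
@[simp] theorem ideleNormDetQuot_mk (H : Matrix (Fin n) (Fin n) L) (g : adelicUnitaryGroup L H) :
    ideleNormDetQuot L H (QuotientGroup.mk g) = ideleNormDet L H g := rfl

/-- On a compact quotient `‖det ·‖_𝔸` is bounded on the whole adelic unitary group. -/
theorem exists_ideleNormDet_le (H : Matrix (Fin n) (Fin n) L) [CompactSpace (adelicUnitaryGroup L H ⧸ adelicUnitaryRat L H)] :
    ∃ B : ℝ≥0, ∀ g : adelicUnitaryGroup L H, ideleNormDet L H g ≤ B := by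
  obtain ⟨B, hB⟩ := (isCompact_range (continuous_ideleNormDetQuot L H)).bddAbove
  exact ⟨B, fun g => hB ⟨QuotientGroup.mk g, rfl⟩⟩

/-! ## The zero form: `U(0) = GL_n`, and scalar ideles have unbounded `‖det‖` -/

/-- Every `g ∈ GL_n(𝔸_L)` preserves the zero form. -/
theorem mem_adelicUnitaryGroup_zero (g : GL (Fin n) 𝔸L) :
    g ∈ adelicUnitaryGroup L (0 : Matrix (Fin n) (Fin n) L) := by
  rw [mem_adelicUnitaryGroup_iff, Matrix.map_zero _ (map_zero _), Matrix.mul_zero, Matrix.zero_mul]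

/-- The scalar matrix `u · 1 ∈ GL_n(𝔸_L)` of an idele `u`. -/
def scalarGL (u : (𝔸L)ˣ) : GL (Fin n) 𝔸L :=
  Units.map (Matrix.scalar (Fin n)).toMonoidHom u

omit [IsCMField L] in
/-- (Ported verbatim from the HodgeCMPerL package; no docstring in the source.) -/
@[simp] theorem coe_scalarGL (u : (𝔸L)ˣ) :
    ((scalarGL L u : GL (Fin n) 𝔸L) : Matrix (Fin n) (Fin n) 𝔸L) = Matrix.scalar (Fin n) (u : 𝔸L) := rfl

omit [IsCMField L] in
/-- (Ported verbatim from the HodgeCMPerL package; no docstring in the source.) -/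
theorem det_scalarGL (u : (𝔸L)ˣ) : Matrix.GeneralLinearGroup.det (scalarGL L (n := n) u) = u ^ n := by
  ext
  rw [Matrix.GeneralLinearGroup.val_det_apply, coe_scalarGL, Matrix.scalar_apply, Matrix.det_diagonal,
    Finset.prod_const, Finset.card_univ, Fintype.card_fin, Units.val_pow_eq_pow_val]

/-- `‖det z(r)·1‖_𝔸 = r ^ (n · [L:ℚ])` for the positive-real scalar idele `z(r)`. -/
theorem ideleNormDet_scalarGL_posRealIdele (r : ℝ≥0ˣ) :
    ideleNormDet L (0 : Matrix (Fin n) (Fin n) L) ⟨scalarGL L (posRealIdele L r), mem_adelicUnitaryGroup_zero L _⟩ =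
      ((r : ℝ≥0) ^ Module.finrank ℚ L) ^ n := by
  unfold ideleNormDet
  rw [det_scalarGL, map_pow,
    show IdeleClassGroup.ideleNorm L (posRealIdele L r) = (r : ℝ≥0) ^ Module.finrank ℚ L from
      ideleNorm_posRealIdele_holds L r]

/-- **`GL_n(L)\GL_n(𝔸_L)` (= the quotient for the ZERO form) is not compact** for `n ≥ 1`. -/
theorem not_adelicQuotientCompact_zero (hn : n ≠ 0) :
    ¬ CompactSpace (adelicUnitaryGroup L (0 : Matrix (Fin n) (Fin n) L) ⧸
        adelicUnitaryRat L (0 : Matrix (Fin n) (Fin n) L)) := by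
  intro hc
  obtain ⟨B, hB⟩ := exists_ideleNormDet_le L (0 : Matrix (Fin n) (Fin n) L)
  -- the scalar idele `z(B + 1)` has `‖det‖ = (B+1)^{[L:ℚ] n} ≥ B + 1 > B`
  have hr : (B + 1 : ℝ≥0) ≠ 0 := (add_pos_of_nonneg_of_pos zero_le one_pos).ne'
  let r : ℝ≥0ˣ := Units.mk0 (B + 1) hr
  have hle := hB ⟨scalarGL L (posRealIdele L r), mem_adelicUnitaryGroup_zero L _⟩
  rw [ideleNormDet_scalarGL_posRealIdele, ← pow_mul] at hle
  have hd : Module.finrank ℚ L * n ≠ 0 := mul_ne_zero Module.finrank_pos.ne' hn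
  have hge : (B + 1 : ℝ≥0) ≤ (B + 1) ^ (Module.finrank ℚ L * n) :=
    le_self_pow₀ (le_add_of_nonneg_left zero_le) hd
  have : (B + 1 : ℝ≥0) ≤ B := hge.trans (by simpa [r] using hle)
  exact absurd this (not_le.mpr (lt_add_one B))

end HodgeCM.PerL34.Godement

/-- **The unconditional variant of `PrintFact_unitaryCompact` is FALSE** (kernel form of the remark in the tree
docstring of `HodgeCM.PrintFact_unitaryCompact`): it is not the case that `U(H)(L⁺)\U(H)(𝔸_{L⁺})` is compact for
every hermitian `H` — witness `L = ℚ(ζ₇)` (`HodgeCM.cyclo7`), `n = 1`, `H = 0`. -/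
theorem HodgeCM.not_printFact_unitaryCompact_unconditional :
    ¬ ∀ (L : CMField) (n : ℕ) (H : Matrix (Fin n) (Fin n) L), (∀ i j, Literature.AlgebraicGeometry.ShimuraVarieties.conjRingHomK L (H i j) = H j i) →
      AdelicQuotientCompact L H := by
  intro h
  have hc := h HodgeCM.cyclo7 1 0 (fun i j => by rw [Matrix.zero_apply, Matrix.zero_apply, map_zero])
  exact HodgeCM.PerL34.Godement.not_adelicQuotientCompact_zero (L := HodgeCM.cyclo7) one_ne_zero hc
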